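import Literature.Barriers.CriticalPhenomena.GridSAWLOTDrawingDict
import Literature.Barriers.CriticalPhenomena.GridSAWLOTDrawingFP
import Literature.Combinatorics.SimpleGraph.HamiltonianLOTStates
import Literature.Combinatorics.SimpleGraph.HamiltonianLOTAdjacency
import HarnessLib

/-!
# Lemma 4 of Liśkiewicz–Ogihara–Toda with the embedding: the named fact discharged

`GridSAW.LOT2003_lemma4_gadgets : SHARP3SATNF ≤ᵖ_{r-shift} GRIDHAMPATHCOUNT`
(`GridSAWCountingGridHamPathHardness.lean`; Liśkiewicz–Ogihara–Toda 2003, Lemma 4 together with the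
embedding step `E₀` of the proof of Theorem 7) is PROVED here, `LOT2003_lemma4_gadgets_holds`, by
feeding the construction of the tree into the approach-independent end
`LOT2003_lemma4_gadgets_of_family` (`GridSAWGadgetsFromDrawnFamily.lean`):

* the gadget graph `graph₂ φ` of a formula `φ` in the normal form of Lemma 3 — the diamond chain of
  its cells with the diamond ladders, pins and OR-gadgets of the first substitution stage and the
  XOR-ladders (hops through the rung diamonds, set ladders, clause links) of the second
  (`HamiltonianLOTLayout/Families/Families2/Count.lean`, after Garey–Johnson–Tarjan and Fig. 2 (b),
  4, 5 of the source) — has exactly `2 · #SAT(φ)` Hamiltonian `0 – (5M-1)` paths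
  (`hamCount_graph₂_eq`, `HamiltonianLOTStates.lean`: "each satisfying assignment is represented by
  exactly `2^{…}` Hamiltonian paths", here `2¹`);
* its vertex set is `{0, …, totalV - 1}` (`verts₂_eq_range`, `HamiltonianLOTVerts.lean`);
* it is drawn on the grid without congestion by the placed tiles of `GridSAWLOTDrawing.lean`
  (`LOTDrawingFP.drawing`, valid by `LOTDrawing.tilingHyps` / `drawing_isValid`; the drawing realises
  exactly the edges of `graph₂ φ`, `LOTDrawing.adj_iff_drawn`, `GridSAWLOTDrawingDict/Edges.lean`) —
  this is `E₀` ("we apply our embedding algorithm to `G′` … for every two edges the paths which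
  realize the edges are vertex disjoint");
* and the data of the drawing are typed polynomial time in the code of `φ`
  (`LOTDrawingFP.codeFP_drawingData`, `GridSAWLOTDrawingFP.lean`: "It is not hard to see that `R`
  is polynomial-time computable").

With `LOT2003_prop2_sharp3SAT_holds` and `LOT2003_lemma3_holds` this closes
`gridSAWCounting_sharpP_complete` (`GridSAWCountingAnyLengthAssembly.lean`) unconditionally
(`gridSAWCountingSharpPComplete_of_gadgets LOT2003_lemma4_gadgets_holds`).

## References

* M. Liśkiewicz, M. Ogihara, S. Toda, *The complexity of counting self-avoiding walks in subgraphs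
  of two-dimensional grids and hypercubes*, Theoret. Comput. Sci. 304 (2003) 129–156, §3 (Lemma 4
  and its proof, Figs. 2, 4, 5) and §4 (proof of Theorem 7, the embedding `E₀`)
  [LiskiewiczOgiharaToda2003].
* M. R. Garey, D. S. Johnson, R. E. Tarjan, *The planar Hamiltonian circuit problem is
  NP-complete*, SIAM J. Comput. 5 (1976) 704–714, §2 (the gadgets).
-/

namespace Literature.Barriers.CriticalPhenomena.GridSAW

open Literature.Computability.Complexity Literature.Computability.Complexity.CodeFP
open Literature.Combinatorics.SimpleGraph Literature.Combinatorics.SimpleGraph.LOTReduction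
open LOTDrawing LOTDrawingFP PData

/-! ### The drawing and its data -/

namespace LOTDrawingFP

variable {φ : CNF ℕ}


variable (φ) in
/-- **The drawing of the gadget graph of `φ`**: the placed tiles of `GridSAWLOTDrawing.lean`,
vertices `0, …, totalV - 1`, positions read off the placement data. [cite: LiskiewiczOgiharaToda2003, §4 (E₀)] -/
def drawing : SDrawing ℕ := assemble (placements φ) (totalV φ) (PData.posD ((placements φ).map PData.ofPlacement))

/-- **The drawing is a valid structured grid drawing** (`N = 3T + 1` odd and positive). [folklore] -/
theorem drawing_isValid (hN : 0 < N φ) (hN3 : N φ = 3 * T φ + 1) (hodd : N φ % 2 = 1) : (drawing φ).IsValid :=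
  (tilingHyps hN hN3 hodd).assemble_posD_isValid

/-- The vertices of the drawing. [folklore] -/
theorem drawing_verts : (drawing φ).verts = List.range (totalV φ) := rfl

/-- **The data of the drawing with ends `s, t`** is `ndOfData` of the placement data. [folklore] -/
theorem drawing_data_eq (s t : ℕ) :
    ((drawing φ).verts, (drawing φ).verts.map (drawing φ).pos, (drawing φ).edges, s, t) = PData.ndOfData (pdataList φ) (totalV φ) s t := by
  rw [pdataList_eq]; exact assemble_data_eq (fun P hP => valid_of_mem hP) s t

/-- **The data of the drawing of `φ` with ends `0` and `5M - 1` are typed polynomial time in the code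
of `φ`** — the hypothesis `hSFP` of `LOT2003_lemma4_gadgets_of_family`. [cite: LiskiewiczOgiharaToda2003, §3 (proof of Lemma 4: "It is not hard to see that `R` is polynomial-time computable")] -/
theorem codeFP_drawingData : CodeFP cnfC ndC
    (fun ψ => ((drawing ψ).verts, (drawing ψ).verts.map (drawing ψ).pos, (drawing ψ).edges, (0 : ℕ), 5 * M ψ - 1)) :=
  ((codeFP_ndOfData.comp (codeFP_pdataList.pair (codeFP_uTotalV.pair ((const _ 0).pair codeFP_tEnd)))).congr fun ψ =>
    (drawing_data_eq (φ := ψ) 0 (5 * M ψ - 1)).symm)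


end LOTDrawingFP

/-- **The size parameters of a formula in the normal form of Lemma 3**: `N = 3T + 1 > 0` cells,
`N` odd (one single-literal clause followed by an even number of three-literal clauses).
[cite: LiskiewiczOgiharaToda2003, Lemma 3] -/
theorem normalForm_params {φ : CNF ℕ} (hφ : φ.IsLOTNormalForm) : 0 < N φ ∧ N φ = 3 * T φ + 1 ∧ N φ % 2 = 1 := by
  obtain ⟨l, rest, rfl, hcp⟩ := hφ.exists_eq
  have h3 := hcp.length_eq_three
  obtain ⟨k, hk⟩ := hcp.even_length
  rw [N_normalForm (l := l) h3, T_normalForm (l := l) h3]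
  omega

/-- **Lemma 4 with the embedding (Liśkiewicz–Ogihara–Toda 2003): `#3SAT_NF ≤ᵖ_{r-shift}
GRIDHAMPATHCOUNT`** — the named fact `LOT2003_lemma4_gadgets` holds. The reduction numbers the grid
drawing of the gadget graph of `ψ_w` (if `ψ_w` is in normal form; an instance without Hamiltonian
paths otherwise) and shifts by `R₃ = 1` bit: `#HamPath = 2 · #SAT(ψ_w)`.
[cite: LiskiewiczOgiharaToda2003, Lemma 4 and §4 (proof of Theorem 7, `E₀`)] -/
theorem LOT2003_lemma4_gadgets_holds : LOT2003_lemma4_gadgets := by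
  refine LOT2003_lemma4_gadgets_of_family drawing graph₂ (fun _ => 0) (fun ψ => 5 * M ψ - 1) (fun _ => 1)
    (fun ψ hψ => ?_) (fun ψ hψ a _ b _ => ?_) (fun ψ _ => ?_) (fun ψ _ => ?_) (fun _ _ => Nat.one_pos) (fun ψ hψ => ?_)
    codeFP_drawingData (CodeFP.const _ 1)
  · obtain ⟨hN, hN3, hodd⟩ := normalForm_params hψ
    exact drawing_isValid hN hN3 hodd
  · obtain ⟨hN, hN3, -⟩ := normalForm_params hψ
    exact adj_iff_drawn hN hN3
  · rw [drawing_verts, List.mem_range]; exact ends_lt_totalV.1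
  · rw [drawing_verts, List.mem_range]; exact ends_lt_totalV.2
  · rw [drawing_verts, List.toFinset_range, ← verts₂_eq_range, pow_one]
    exact hamCount_graph₂_eq hψ

end Literature.Barriers.CriticalPhenomena.GridSAW
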